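import Mathlib
import Summits.QuantumFields.YangMills.Theorems.CoarseStiffnessTailCappedCoarseStiffnessLThreeTails
import Summits.QuantumFields.YangMills.Theorems.CoarseStiffnessTailCappedCoarseStiffnessLUniformMeanAction
import Summits.QuantumFields.YangMills.Theorems.CoarseStiffnessTailCappedCoarseStiffnessLUnitSlice

/-!
# Route `CoarseStiffnessTail` — THE TWO OPEN STUBS OF `CappedCoarseStiffnessL` (stmt-QuantumFields-25301) ARE STATEMENTS ABOUT THE
# UNIT-LATTICE AVERAGED FIELD ONLY: depth removal `S1 ⇔ S1_top`, `S2 ⇔ S2_top`, `crux ⇔ S1_top ∧ S2_top`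
# (lead's certificate, seat `ym-line-cst-p1` g20; helper on 25301; skeleton v9's composition)

Write `β_h = (γL^{-h})⁻¹`, `θ_γ(h) = θBal L γ b₀ p₀ h` (`= g_h·p(g_h)`, `g_h² = γL^{-h}`, `p = B10.pFun b₀ p₀`), `Ū^{j}` = the `j`-fold
(0.4)-block-averaged field of run `K` (finest lattice `2L^{m+K}` sites per direction, Wilson law `Gibbs_K` at `β_K`), `N_j` = the number of
level-`j` plaquettes `a` with `θ_γ(K−j) ≤ |Ū^{j}(∂a) − 1|`, `Y_j = Σ_a |Ū^{j}(∂a) − 1|²·1[|Ū^{j}(∂a) − 1| < θ_γ(K−j)]`.  The registered skeleton v8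
(`Cruxes/CappedCoarseStiffnessL/Lines/birth.lean`, g15) has exactly two open stubs, both carrying a DEPTH parameter `j₀`:

  S1 `stub_uniformLargeFieldCountDeep`  : `∀ L b₀ p₀ ∃ j₀ c₀ C₀ γ₁ ∀ F γ K j, j₀ < j ≤ K → ∫ exp(c₀·p(g_{K−j})²·N_j) dGibbs_K ≤ e^{C₀·#Plaq_j}`,
  S2 `stub_subThresholdStiffnessDeep`   : `∀ L b₀ p₀ ∃ j₀ c₀ C₀ γ₁ ∀ F γ K j, j₀ < j ≤ K → ∫ exp(c₀·β_{K−j}·Y_j) dGibbs_K ≤ e^{C₀·#Plaq_j}`.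

THE THEOREMS (definition-free; every statement written out in the crux's quantifier format).
* §1 ★ `integral_exp_plaqFun_eq_refine` — g4's refinement transport (`…LUnitSlice.integral_capTilt_eq_refine`) for an ARBITRARY plaquette
  function `g`: run `j + d` of `F` at height `j`, coupling `γ`, IS run `j` of `F.refine d` (volume exponent `m + d`) at its TOP level, coupling
  `γL^{-d}` — same finest lattice, same Wilson weight (`T3Family.refine_β`), block averagings matched level by level (`T3LevelShift.iter_fieldShift`).
* §2 ★★ `uniformLargeFieldCount_of_unitLargeFieldCount` / `unitLargeFieldCount_of_uniformLargeFieldCount` and the BULK analogues — the EDGE and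
  BULK conjuncts of g8's exact factorisation (`…LEdgeBulkFactorisation`, all heights `j ≤ K`) are EQUIVALENT, constants kept, to their TOP SLICES `j = K`:
    S1_top (UnitLargeFieldCount)       : `∀ L b₀ p₀ ∃ c₀ C₀ γ₁ ∀ F γ K: ∫ exp(c₀·p(√γ)²·N_K) dGibbs_K ≤ e^{C₀·#Plaq_K}`,
    S2_top (UnitSubThresholdStiffness) : `∀ L b₀ p₀ ∃ c₀ C₀ γ₁ ∀ F γ K: ∫ exp(c₀·γ⁻¹·Y_K) dGibbs_K ≤ e^{C₀·#Plaq_K}`,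
  statements about the `K`-fold averaged field on the UNIT lattice (`2L^m` sites per direction) at the unit coupling `γ` and window `θ_γ(0) = √γ·p(√γ)`,
  uniform in the cut-off `K`, the volume exponent `m` and the coupling `γ ≤ γ₁` — and in nothing else.
* §3 ★★★ `cappedCoarseStiffnessL_iff_unitStubs` : `CappedCoarseStiffnessL ⇔ S1_top ∧ S2_top` (`cappedCoarseStiffnessL_of_unitStubs` is skeleton
  v9's composition; `unitStubs_of_cappedCoarseStiffnessL` its exactness).
* §4 ★★ `edgeDeep_iff_unitLargeFieldCount`, `bulkDeep_iff_unitSubThresholdStiffness` : v8's registered stubs S1, S2 ⇔ S1_top, S2_top — the depth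
  parameter `j₀` is SPURIOUS (bounded depths: g13's `…LEdgeBoundedDepth` for S1; g14's `…LThreeTails.subThresholdStiffness_of_deep_and_ubs` with the
  CLOSED stub S3 `…LUniformMeanAction.stub_uniformMeanAction` (g15) and g12's `ubs_of_uma` for S2).  Nothing registered earlier is lost.

READING (for planners / a siege / the disprover / the instrument; nothing below is a claim about Bałaban's estimates).
(1) The open content of 25301 is, exactly: two exponential-moment bounds for the unit-lattice averaged field of the `K`-th approximation, uniform in
    `(K, m, γ)`: S1_top = the joint Peierls bound «unit-scale large fields of `Ū^{K}` are `e^{−c₀p(g₀)²}`-rare per plaquette» = [Balaban1985UV3] (71)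
    p.273 at the LAST renormalisation step, summed over large-field sets and integrated against the Gibbs law (ultraviolet stability of the
    large-field suppression); S2_top = Gaussian small-field stiffness of `Ū^{K}` at its own coupling `γ⁻¹` ((5) p.256 at two couplings / (70)).
    Heights `j < K`, depths `j₀`, and the height-uniformity clause of the crux are bookkeeping (g4 for the crux; this file for the stubs).
(2) A planner re-type «25301 := S1_top» (consumers read the EDGE conjunct only, g5/g8) now has a one-line registered signature; a siege on S1_top
    works with one parameter fewer; the disprover's and the instrument's natural object (top-slice counts at fixed `γ`, growing `K`) IS the stub.

HONEST SCOPE.  Transport and bookkeeping over landed certificates; NO estimate of any Gibbs integral is proved here; S1_top, S2_top, the crux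
25301, `HistoryTailL` 19936 and every rung above stay OPEN; `YM3TorusSU2` (rung R3, a RECORD rung, not the Clay statement) is NOT proved; the
Yang–Mills mass gap is NOT touched.

References: T. Bałaban, CMP **102** (1985) 255–275 [Balaban1985UV3] ((1)–(3), (5) p.256; (7) p.257; (70)–(71) p.273); T. Bałaban, CMP **109**
(1987) 249–301 [Balaban1987RG1] ((0.4)/(0.11) p.253: the block averaging and its iteration).
-/

noncomputable section

namespace Summit.QuantumFields.YangMills.Theorems.CoarseStiffnessTailUnitLatticeStubs

open MeasureTheory Finset
open Literature.MathematicalPhysics.QuantumFieldTheory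
open Literature.MathematicalPhysics.QuantumFieldTheory.Balaban1983to89
open Literature.MathematicalPhysics.QuantumFieldTheory.Balaban1983to89.T3ContinuumYM3Torus
open Literature.MathematicalPhysics.QuantumFieldTheory.Balaban1983to89.T3UnitScaleTilt
open Literature.MathematicalPhysics.QuantumFieldTheory.Balaban1983to89.T3UnitLawDensityEML
open Literature.MathematicalPhysics.QuantumFieldTheory.Balaban1983to89.T3LevelShift
open Literature.MathematicalPhysics.QuantumFieldTheory.Balaban1983to89.T3ThresholdRemoval
open Summit.QuantumFields.YangMills.Theorems.CoarseStiffnessTailUnitSlice (sum_plaq_fieldShift card_plaq_eq_refine θBal_eq_θBal_refine_zero)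
open Summit.QuantumFields.YangMills.Theorems.CoarseStiffnessTailPressureConvexity (ubs_of_uma)
open Summit.QuantumFields.YangMills.Theorems.CoarseStiffnessTailBareUniformCount (uniformLargeFieldCount_of_pos)
open Summit.QuantumFields.YangMills.Theorems.CoarseStiffnessTailEdgeBulkFactorisation
  (cappedCoarseStiffnessL_of_subThreshold_and_uniformCount uniformLargeFieldCount_of_cappedCoarseStiffnessL
    subThresholdStiffness_of_cappedCoarseStiffnessL)
open Summit.QuantumFields.YangMills.Theorems.CoarseStiffnessTailDeepTailReduction (uniformLargeFieldCountPos_of_deep)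
open Summit.QuantumFields.YangMills.Theorems.CoarseStiffnessTailThreeTails (subThresholdStiffness_of_deep_and_ubs)
open Summit.QuantumFields.YangMills.Theorems.CoarseStiffnessTailUniformMeanAction (stub_uniformMeanAction)

/-! ## §1 Transport: a Gibbs integral of ANY level-`j` plaquette functional of run `j + d` is a top-slice integral of run `j` of `F.refine d` -/

section Transport

variable (F : T3Family)

/-- ★ **RUN `j + d` OF `F` AT HEIGHT `j` IS THE TOP OF RUN `j` OF `F.refine d`, FOR EVERY PLAQUETTE FUNCTION `g`**: the Gibbs integral (run
`j + d`, coupling `γ`) of `exp(c·Σ_a g(Ū^{j}(∂a)))` over the level-`j` plaquettes equals the Gibbs integral (run `j` of `F.refine d`, coupling `γL^{-d}`)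
of the same functional of ITS level-`j` = unit-lattice averaged field (`T3ThresholdRemoval.integral_gibbsMeasure_comp_fieldShift`, `T3Family.refine_β`,
`T3LevelShift.iter_fieldShift`, `…LUnitSlice.sum_plaq_fieldShift`; g4's `integral_capTilt_eq_refine` is the case `g = min(dist1² , t²)`).
[cite: Balaban1985UV3, (1)-(3) p.256] -/
theorem integral_exp_plaqFun_eq_refine {γ : ℝ} (hγ : 0 ≤ γ) (c : ℝ) (g : Matrix.specialUnitaryGroup (Fin 2) ℂ → ℝ) (d j : ℕ) :
    ∫ U, Real.exp (c * ∑ a : Plaq (F.P (j + d)) j, g (GaugeField.plaqHol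
        (Averaging.iter (fun i => BlockAveraging.blockAvg (P := F.P (j + d)) (j := i) T3UnitLawDensityEML.ℰp) j U) a))
        ∂(T3UnitScaleTilt.gibbsK F T3UnitLawDensityEML.ℰp γ (j + d)) =
      ∫ V, Real.exp (c * ∑ a' : Plaq ((F.refine d).P j) j, g (GaugeField.plaqHol
        (Averaging.iter (fun i => BlockAveraging.blockAvg (P := (F.refine d).P j) (j := i) T3UnitLawDensityEML.ℰp) j V) a'))
        ∂(T3UnitScaleTilt.gibbsK (F.refine d) T3UnitLawDensityEML.ℰp (γ * ((F.L : ℝ)⁻¹) ^ d) j) := by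
  have hβ : ((F.refine d).scheme ℰp (γ * ((F.L : ℝ)⁻¹) ^ d)).β j = (F.scheme ℰp γ).β (j + d) := F.refine_β ℰp γ d j
  have hβ0 : 0 ≤ (F.scheme ℰp γ).β (j + d) := F.scheme_β_nonneg ℰp hγ (j + d)
  have hmK : F.m + (j + d) = F.m + d + j := by omega
  rw [gibbsK_eq, gibbsK_eq, hβ]
  refine ((integral_gibbsMeasure_comp_fieldShift (G := Matrix.specialUnitaryGroup (Fin 2) ℂ)
    (sitesPerDir_refine_zero F d j) hβ0 _).symm).trans ?_
  refine integral_congr_ae (Filter.Eventually.of_forall fun V => ?_)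
  have key := iter_fieldShift ℰp hmK j V
  simp only
  erw [key]
  exact congrArg (fun x : ℝ => Real.exp (c * x)) (sum_plaq_fieldShift F _ _ g)

/-- Bookkeeping for the top slice: `γ·(L⁻¹)^(K − K) = γ`. [folklore] -/
theorem coupling_sub_self (γ : ℝ) (L K : ℕ) : γ * ((L : ℝ)⁻¹) ^ (K - K) = γ := by
  rw [Nat.sub_self, pow_zero, mul_one]

/-- Admissibility of the refined coupling: `0 < γL^{-d} ≤ γ`. [folklore] -/
theorem coupling_refine_pos_le {γ : ℝ} (hγ : 0 < γ) (d : ℕ) :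
    0 < γ * ((F.L : ℝ)⁻¹) ^ d ∧ γ * ((F.L : ℝ)⁻¹) ^ d ≤ γ := by
  have hL0 : (0 : ℝ) < F.L := by exact_mod_cast (lt_trans zero_lt_one F.hL.2)
  have hL1 : (1 : ℝ) ≤ F.L := by exact_mod_cast F.hL.2.le
  have hLinv : ((F.L : ℝ)⁻¹) ^ d ≤ 1 := pow_le_one₀ (inv_nonneg.mpr hL0.le) (inv_le_one_of_one_le₀ hL1)
  exact ⟨mul_pos hγ (pow_pos (inv_pos.mpr hL0) _), mul_le_of_le_one_right hγ.le hLinv⟩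

end Transport

/-! ## §2 The EDGE and BULK conjuncts (all heights) ⇔ their top slices `j = K` (constants kept) -/

section Edge

/-- **EDGE (all heights) ⇒ S1_top** (specialise `j := K`). [cite: Balaban1985UV3, (71) p.273] -/
theorem unitLargeFieldCount_of_uniformLargeFieldCount
    (h : ∀ (L : ℕ) (b₀ p₀ : ℝ), 0 < b₀ → 2 < p₀ → ∃ (c₀ C₀ γ₁ : ℝ), 0 < c₀ ∧ 0 < γ₁ ∧ γ₁ ≤ 1 ∧
      ∀ (F : T3Family) (γ : ℝ), F.L = L → 0 < γ → γ ≤ γ₁ → ∀ (K j : ℕ), j ≤ K →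
        ∫ U, Real.exp (c₀ * B10.pFun b₀ p₀ (Real.sqrt (γ * ((F.L : ℝ)⁻¹) ^ (K - j))) ^ 2 *
            ∑ a : Plaq (F.P K) j, (if T3UnitScaleTilt.θBal F.L γ b₀ p₀ (K - j) ≤ GaugeGroup.dist1 (GaugeField.plaqHol
              (Averaging.iter (fun i => BlockAveraging.blockAvg (P := F.P K) (j := i) T3UnitLawDensityEML.ℰp) j U) a)
              then (1 : ℝ) else 0)) ∂(T3UnitScaleTilt.gibbsK F T3UnitLawDensityEML.ℰp γ K) ≤
          Real.exp (C₀ * (Fintype.card (Plaq (F.P K) j) : ℝ))) :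
    ∀ (L : ℕ) (b₀ p₀ : ℝ), 0 < b₀ → 2 < p₀ → ∃ (c₀ C₀ γ₁ : ℝ), 0 < c₀ ∧ 0 < γ₁ ∧ γ₁ ≤ 1 ∧
      ∀ (F : T3Family) (γ : ℝ), F.L = L → 0 < γ → γ ≤ γ₁ → ∀ (K : ℕ),
        ∫ U, Real.exp (c₀ * B10.pFun b₀ p₀ (Real.sqrt γ) ^ 2 *
            ∑ a : Plaq (F.P K) K, (if T3UnitScaleTilt.θBal F.L γ b₀ p₀ 0 ≤ GaugeGroup.dist1 (GaugeField.plaqHol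
              (Averaging.iter (fun i => BlockAveraging.blockAvg (P := F.P K) (j := i) T3UnitLawDensityEML.ℰp) K U) a)
              then (1 : ℝ) else 0)) ∂(T3UnitScaleTilt.gibbsK F T3UnitLawDensityEML.ℰp γ K) ≤
          Real.exp (C₀ * (Fintype.card (Plaq (F.P K) K) : ℝ)) := by
  intro L b₀ p₀ hb₀ hp₀
  obtain ⟨c₀, C₀, γ₁, hc₀, hγ₁, hγ₁1, hb⟩ := h L b₀ p₀ hb₀ hp₀
  refine ⟨c₀, C₀, γ₁, hc₀, hγ₁, hγ₁1, fun F γ hFL hγ hγγ₁ K => ?_⟩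
  have key := hb F γ hFL hγ hγγ₁ K K le_rfl
  rw [coupling_sub_self, Nat.sub_self] at key
  exact key

/-- **S1_top ⇒ EDGE (all heights)** — THE DEPTH REMOVAL: the EDGE bound at cut-off `K = j + d`, height `j`, for `(F, γ)` is the top-slice bound for
`(F.refine d, γL^{-d})` at cut-off `j` (§1 with `g = 1[θ ≤ dist1]`; the rate `p(g_{K−j}(γ))² = p(√(γL^{-d}))²`, the window `θ_γ(d) = θ_{γL^{-d}}(0)`,
`…LUnitSlice.θBal_eq_θBal_refine_zero`; plaquette counts agree, `card_plaq_eq_refine`); `γL^{-d} ≤ γ ≤ γ₁` is admissible; constants kept.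
[cite: Balaban1985UV3, (1)-(3) p.256 and (71) p.273] -/
theorem uniformLargeFieldCount_of_unitLargeFieldCount
    (h : ∀ (L : ℕ) (b₀ p₀ : ℝ), 0 < b₀ → 2 < p₀ → ∃ (c₀ C₀ γ₁ : ℝ), 0 < c₀ ∧ 0 < γ₁ ∧ γ₁ ≤ 1 ∧
      ∀ (F : T3Family) (γ : ℝ), F.L = L → 0 < γ → γ ≤ γ₁ → ∀ (K : ℕ),
        ∫ U, Real.exp (c₀ * B10.pFun b₀ p₀ (Real.sqrt γ) ^ 2 *
            ∑ a : Plaq (F.P K) K, (if T3UnitScaleTilt.θBal F.L γ b₀ p₀ 0 ≤ GaugeGroup.dist1 (GaugeField.plaqHol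
              (Averaging.iter (fun i => BlockAveraging.blockAvg (P := F.P K) (j := i) T3UnitLawDensityEML.ℰp) K U) a)
              then (1 : ℝ) else 0)) ∂(T3UnitScaleTilt.gibbsK F T3UnitLawDensityEML.ℰp γ K) ≤
          Real.exp (C₀ * (Fintype.card (Plaq (F.P K) K) : ℝ))) :
    ∀ (L : ℕ) (b₀ p₀ : ℝ), 0 < b₀ → 2 < p₀ → ∃ (c₀ C₀ γ₁ : ℝ), 0 < c₀ ∧ 0 < γ₁ ∧ γ₁ ≤ 1 ∧
      ∀ (F : T3Family) (γ : ℝ), F.L = L → 0 < γ → γ ≤ γ₁ → ∀ (K j : ℕ), j ≤ K →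
        ∫ U, Real.exp (c₀ * B10.pFun b₀ p₀ (Real.sqrt (γ * ((F.L : ℝ)⁻¹) ^ (K - j))) ^ 2 *
            ∑ a : Plaq (F.P K) j, (if T3UnitScaleTilt.θBal F.L γ b₀ p₀ (K - j) ≤ GaugeGroup.dist1 (GaugeField.plaqHol
              (Averaging.iter (fun i => BlockAveraging.blockAvg (P := F.P K) (j := i) T3UnitLawDensityEML.ℰp) j U) a)
              then (1 : ℝ) else 0)) ∂(T3UnitScaleTilt.gibbsK F T3UnitLawDensityEML.ℰp γ K) ≤
          Real.exp (C₀ * (Fintype.card (Plaq (F.P K) j) : ℝ)) := by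
  intro L b₀ p₀ hb₀ hp₀
  obtain ⟨c₀, C₀, γ₁, hc₀, hγ₁, hγ₁1, hTop⟩ := h L b₀ p₀ hb₀ hp₀
  refine ⟨c₀, C₀, γ₁, hc₀, hγ₁, hγ₁1, fun F γ hFL hγ hγγ₁ K j hjK => ?_⟩
  obtain ⟨d, rfl⟩ := Nat.exists_eq_add_of_le hjK
  obtain ⟨hγ', hγ'le⟩ := coupling_refine_pos_le F hγ d
  have key := hTop (F.refine d) (γ * ((F.L : ℝ)⁻¹) ^ d) hFL hγ' (hγ'le.trans hγγ₁) j
  rw [Nat.add_sub_cancel_left,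
    integral_exp_plaqFun_eq_refine F hγ.le _ (fun u => if T3UnitScaleTilt.θBal F.L γ b₀ p₀ d ≤ GaugeGroup.dist1 u then (1 : ℝ) else 0),
    card_plaq_eq_refine, θBal_eq_θBal_refine_zero F.L γ b₀ p₀ d]
  exact key

end Edge

section Bulk

/-- **BULK (all heights) ⇒ S2_top** (specialise `j := K`: `β_{K−K} = γ⁻¹`, `θ_γ(K − K) = θ_γ(0)`). [cite: Balaban1985UV3, (5) p.256] -/
theorem unitSubThresholdStiffness_of_subThresholdStiffness
    (h : ∀ (L : ℕ) (b₀ p₀ : ℝ), 0 < b₀ → 2 < p₀ → ∃ (c₀ C₀ γ₁ : ℝ), 0 < c₀ ∧ 0 < γ₁ ∧ γ₁ ≤ 1 ∧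
      ∀ (F : T3Family) (γ : ℝ), F.L = L → 0 < γ → γ ≤ γ₁ → ∀ (K j : ℕ), j ≤ K →
        ∫ U, Real.exp (c₀ * (γ * ((F.L : ℝ)⁻¹) ^ (K - j))⁻¹ *
            ∑ a : Plaq (F.P K) j, (if GaugeGroup.dist1 (GaugeField.plaqHol
              (Averaging.iter (fun i => BlockAveraging.blockAvg (P := F.P K) (j := i) T3UnitLawDensityEML.ℰp) j U) a) <
                T3UnitScaleTilt.θBal F.L γ b₀ p₀ (K - j) then
              GaugeGroup.dist1 (GaugeField.plaqHol
                (Averaging.iter (fun i => BlockAveraging.blockAvg (P := F.P K) (j := i) T3UnitLawDensityEML.ℰp) j U) a) ^ 2 else 0))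
            ∂(T3UnitScaleTilt.gibbsK F T3UnitLawDensityEML.ℰp γ K) ≤
          Real.exp (C₀ * (Fintype.card (Plaq (F.P K) j) : ℝ))) :
    ∀ (L : ℕ) (b₀ p₀ : ℝ), 0 < b₀ → 2 < p₀ → ∃ (c₀ C₀ γ₁ : ℝ), 0 < c₀ ∧ 0 < γ₁ ∧ γ₁ ≤ 1 ∧
      ∀ (F : T3Family) (γ : ℝ), F.L = L → 0 < γ → γ ≤ γ₁ → ∀ (K : ℕ),
        ∫ U, Real.exp (c₀ * γ⁻¹ *
            ∑ a : Plaq (F.P K) K, (if GaugeGroup.dist1 (GaugeField.plaqHol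
              (Averaging.iter (fun i => BlockAveraging.blockAvg (P := F.P K) (j := i) T3UnitLawDensityEML.ℰp) K U) a) <
                T3UnitScaleTilt.θBal F.L γ b₀ p₀ 0 then
              GaugeGroup.dist1 (GaugeField.plaqHol
                (Averaging.iter (fun i => BlockAveraging.blockAvg (P := F.P K) (j := i) T3UnitLawDensityEML.ℰp) K U) a) ^ 2 else 0))
            ∂(T3UnitScaleTilt.gibbsK F T3UnitLawDensityEML.ℰp γ K) ≤
          Real.exp (C₀ * (Fintype.card (Plaq (F.P K) K) : ℝ)) := by
  intro L b₀ p₀ hb₀ hp₀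
  obtain ⟨c₀, C₀, γ₁, hc₀, hγ₁, hγ₁1, hb⟩ := h L b₀ p₀ hb₀ hp₀
  refine ⟨c₀, C₀, γ₁, hc₀, hγ₁, hγ₁1, fun F γ hFL hγ hγγ₁ K => ?_⟩
  have key := hb F γ hFL hγ hγγ₁ K K le_rfl
  rw [coupling_sub_self, Nat.sub_self] at key
  exact key

/-- **S2_top ⇒ BULK (all heights)** — THE DEPTH REMOVAL (§1 with `g = dist1²·1[dist1 < θ]`; `β_{K−j}(γ) = (γL^{-d})⁻¹` for `K = j + d`; window
and plaquette count as in the EDGE case); constants kept. [cite: Balaban1985UV3, (1)-(3) p.256 and (5) p.256] -/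
theorem subThresholdStiffness_of_unitSubThresholdStiffness
    (h : ∀ (L : ℕ) (b₀ p₀ : ℝ), 0 < b₀ → 2 < p₀ → ∃ (c₀ C₀ γ₁ : ℝ), 0 < c₀ ∧ 0 < γ₁ ∧ γ₁ ≤ 1 ∧
      ∀ (F : T3Family) (γ : ℝ), F.L = L → 0 < γ → γ ≤ γ₁ → ∀ (K : ℕ),
        ∫ U, Real.exp (c₀ * γ⁻¹ *
            ∑ a : Plaq (F.P K) K, (if GaugeGroup.dist1 (GaugeField.plaqHol
              (Averaging.iter (fun i => BlockAveraging.blockAvg (P := F.P K) (j := i) T3UnitLawDensityEML.ℰp) K U) a) <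
                T3UnitScaleTilt.θBal F.L γ b₀ p₀ 0 then
              GaugeGroup.dist1 (GaugeField.plaqHol
                (Averaging.iter (fun i => BlockAveraging.blockAvg (P := F.P K) (j := i) T3UnitLawDensityEML.ℰp) K U) a) ^ 2 else 0))
            ∂(T3UnitScaleTilt.gibbsK F T3UnitLawDensityEML.ℰp γ K) ≤
          Real.exp (C₀ * (Fintype.card (Plaq (F.P K) K) : ℝ))) :
    ∀ (L : ℕ) (b₀ p₀ : ℝ), 0 < b₀ → 2 < p₀ → ∃ (c₀ C₀ γ₁ : ℝ), 0 < c₀ ∧ 0 < γ₁ ∧ γ₁ ≤ 1 ∧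
      ∀ (F : T3Family) (γ : ℝ), F.L = L → 0 < γ → γ ≤ γ₁ → ∀ (K j : ℕ), j ≤ K →
        ∫ U, Real.exp (c₀ * (γ * ((F.L : ℝ)⁻¹) ^ (K - j))⁻¹ *
            ∑ a : Plaq (F.P K) j, (if GaugeGroup.dist1 (GaugeField.plaqHol
              (Averaging.iter (fun i => BlockAveraging.blockAvg (P := F.P K) (j := i) T3UnitLawDensityEML.ℰp) j U) a) <
                T3UnitScaleTilt.θBal F.L γ b₀ p₀ (K - j) then
              GaugeGroup.dist1 (GaugeField.plaqHol
                (Averaging.iter (fun i => BlockAveraging.blockAvg (P := F.P K) (j := i) T3UnitLawDensityEML.ℰp) j U) a) ^ 2 else 0))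
            ∂(T3UnitScaleTilt.gibbsK F T3UnitLawDensityEML.ℰp γ K) ≤
          Real.exp (C₀ * (Fintype.card (Plaq (F.P K) j) : ℝ)) := by
  intro L b₀ p₀ hb₀ hp₀
  obtain ⟨c₀, C₀, γ₁, hc₀, hγ₁, hγ₁1, hTop⟩ := h L b₀ p₀ hb₀ hp₀
  refine ⟨c₀, C₀, γ₁, hc₀, hγ₁, hγ₁1, fun F γ hFL hγ hγγ₁ K j hjK => ?_⟩
  obtain ⟨d, rfl⟩ := Nat.exists_eq_add_of_le hjK
  obtain ⟨hγ', hγ'le⟩ := coupling_refine_pos_le F hγ d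
  have key := hTop (F.refine d) (γ * ((F.L : ℝ)⁻¹) ^ d) hFL hγ' (hγ'le.trans hγγ₁) j
  rw [Nat.add_sub_cancel_left,
    integral_exp_plaqFun_eq_refine F hγ.le _ (fun u => if GaugeGroup.dist1 u < T3UnitScaleTilt.θBal F.L γ b₀ p₀ d then
      GaugeGroup.dist1 u ^ 2 else 0),
    card_plaq_eq_refine, θBal_eq_θBal_refine_zero F.L γ b₀ p₀ d]
  exact key

end Bulk

/-! ## §3 The crux ⇔ S1_top ∧ S2_top (skeleton v9's composition and its exactness) -/

section Crux

/-- ★★★ **S1_top ∧ S2_top ⇒ THE CRUX** (skeleton v9's composition): depth removal (§2), then g8's `cappedCoarseStiffnessL_of_subThreshold_and_uniformCount`.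
S1_top is [Balaban1985UV3] (71) p.273 at the last step, summed over large-field sets and integrated against the Gibbs law; S2_top is (5) p.256 at two
couplings / (70) p.273 — both OPEN (XL). [cite: Balaban1985UV3, (5) p.256 and (71) p.273] -/
theorem cappedCoarseStiffnessL_of_unitStubs
    (hE : ∀ (L : ℕ) (b₀ p₀ : ℝ), 0 < b₀ → 2 < p₀ → ∃ (c₀ C₀ γ₁ : ℝ), 0 < c₀ ∧ 0 < γ₁ ∧ γ₁ ≤ 1 ∧
      ∀ (F : T3Family) (γ : ℝ), F.L = L → 0 < γ → γ ≤ γ₁ → ∀ (K : ℕ),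
        ∫ U, Real.exp (c₀ * B10.pFun b₀ p₀ (Real.sqrt γ) ^ 2 *
            ∑ a : Plaq (F.P K) K, (if T3UnitScaleTilt.θBal F.L γ b₀ p₀ 0 ≤ GaugeGroup.dist1 (GaugeField.plaqHol
              (Averaging.iter (fun i => BlockAveraging.blockAvg (P := F.P K) (j := i) T3UnitLawDensityEML.ℰp) K U) a)
              then (1 : ℝ) else 0)) ∂(T3UnitScaleTilt.gibbsK F T3UnitLawDensityEML.ℰp γ K) ≤
          Real.exp (C₀ * (Fintype.card (Plaq (F.P K) K) : ℝ)))
    (hB : ∀ (L : ℕ) (b₀ p₀ : ℝ), 0 < b₀ → 2 < p₀ → ∃ (c₀ C₀ γ₁ : ℝ), 0 < c₀ ∧ 0 < γ₁ ∧ γ₁ ≤ 1 ∧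
      ∀ (F : T3Family) (γ : ℝ), F.L = L → 0 < γ → γ ≤ γ₁ → ∀ (K : ℕ),
        ∫ U, Real.exp (c₀ * γ⁻¹ *
            ∑ a : Plaq (F.P K) K, (if GaugeGroup.dist1 (GaugeField.plaqHol
              (Averaging.iter (fun i => BlockAveraging.blockAvg (P := F.P K) (j := i) T3UnitLawDensityEML.ℰp) K U) a) <
                T3UnitScaleTilt.θBal F.L γ b₀ p₀ 0 then
              GaugeGroup.dist1 (GaugeField.plaqHol
                (Averaging.iter (fun i => BlockAveraging.blockAvg (P := F.P K) (j := i) T3UnitLawDensityEML.ℰp) K U) a) ^ 2 else 0))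
            ∂(T3UnitScaleTilt.gibbsK F T3UnitLawDensityEML.ℰp γ K) ≤
          Real.exp (C₀ * (Fintype.card (Plaq (F.P K) K) : ℝ))) :
    Summit.QuantumFields.YangMills.Theses.CoarseStiffnessTail.CappedCoarseStiffnessL :=
  cappedCoarseStiffnessL_of_subThreshold_and_uniformCount (subThresholdStiffness_of_unitSubThresholdStiffness hB)
    (uniformLargeFieldCount_of_unitLargeFieldCount hE)

/-- ★★★ **THE CRUX ⇒ S1_top ∧ S2_top** (g8's `uniformLargeFieldCount_of_cappedCoarseStiffnessL` / `subThresholdStiffness_of_cappedCoarseStiffnessL`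
at `j = K`): the two top-slice stubs are FACTORS of the crux, not strengthenings. [cite: Balaban1985UV3, (5) p.256 and (71) p.273] -/
theorem unitStubs_of_cappedCoarseStiffnessL (h : Summit.QuantumFields.YangMills.Theses.CoarseStiffnessTail.CappedCoarseStiffnessL) :
    (∀ (L : ℕ) (b₀ p₀ : ℝ), 0 < b₀ → 2 < p₀ → ∃ (c₀ C₀ γ₁ : ℝ), 0 < c₀ ∧ 0 < γ₁ ∧ γ₁ ≤ 1 ∧
      ∀ (F : T3Family) (γ : ℝ), F.L = L → 0 < γ → γ ≤ γ₁ → ∀ (K : ℕ),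
        ∫ U, Real.exp (c₀ * B10.pFun b₀ p₀ (Real.sqrt γ) ^ 2 *
            ∑ a : Plaq (F.P K) K, (if T3UnitScaleTilt.θBal F.L γ b₀ p₀ 0 ≤ GaugeGroup.dist1 (GaugeField.plaqHol
              (Averaging.iter (fun i => BlockAveraging.blockAvg (P := F.P K) (j := i) T3UnitLawDensityEML.ℰp) K U) a)
              then (1 : ℝ) else 0)) ∂(T3UnitScaleTilt.gibbsK F T3UnitLawDensityEML.ℰp γ K) ≤
          Real.exp (C₀ * (Fintype.card (Plaq (F.P K) K) : ℝ))) ∧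
    (∀ (L : ℕ) (b₀ p₀ : ℝ), 0 < b₀ → 2 < p₀ → ∃ (c₀ C₀ γ₁ : ℝ), 0 < c₀ ∧ 0 < γ₁ ∧ γ₁ ≤ 1 ∧
      ∀ (F : T3Family) (γ : ℝ), F.L = L → 0 < γ → γ ≤ γ₁ → ∀ (K : ℕ),
        ∫ U, Real.exp (c₀ * γ⁻¹ *
            ∑ a : Plaq (F.P K) K, (if GaugeGroup.dist1 (GaugeField.plaqHol
              (Averaging.iter (fun i => BlockAveraging.blockAvg (P := F.P K) (j := i) T3UnitLawDensityEML.ℰp) K U) a) <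
                T3UnitScaleTilt.θBal F.L γ b₀ p₀ 0 then
              GaugeGroup.dist1 (GaugeField.plaqHol
                (Averaging.iter (fun i => BlockAveraging.blockAvg (P := F.P K) (j := i) T3UnitLawDensityEML.ℰp) K U) a) ^ 2 else 0))
            ∂(T3UnitScaleTilt.gibbsK F T3UnitLawDensityEML.ℰp γ K) ≤
          Real.exp (C₀ * (Fintype.card (Plaq (F.P K) K) : ℝ))) :=
  ⟨unitLargeFieldCount_of_uniformLargeFieldCount (uniformLargeFieldCount_of_cappedCoarseStiffnessL h),
    unitSubThresholdStiffness_of_subThresholdStiffness (subThresholdStiffness_of_cappedCoarseStiffnessL h)⟩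

/-- ★★★ **`CappedCoarseStiffnessL ⇔ S1_top ∧ S2_top`**: the crux (stmt-QuantumFields-25301) IS the conjunction of two exponential-moment bounds for the
unit-lattice averaged field of the `K`-th approximation, uniform in `(K, m, γ ≤ γ₁)`. [cite: Balaban1985UV3, (5) p.256 and (71) p.273] -/
theorem cappedCoarseStiffnessL_iff_unitStubs :
    Summit.QuantumFields.YangMills.Theses.CoarseStiffnessTail.CappedCoarseStiffnessL ↔
    ((∀ (L : ℕ) (b₀ p₀ : ℝ), 0 < b₀ → 2 < p₀ → ∃ (c₀ C₀ γ₁ : ℝ), 0 < c₀ ∧ 0 < γ₁ ∧ γ₁ ≤ 1 ∧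
      ∀ (F : T3Family) (γ : ℝ), F.L = L → 0 < γ → γ ≤ γ₁ → ∀ (K : ℕ),
        ∫ U, Real.exp (c₀ * B10.pFun b₀ p₀ (Real.sqrt γ) ^ 2 *
            ∑ a : Plaq (F.P K) K, (if T3UnitScaleTilt.θBal F.L γ b₀ p₀ 0 ≤ GaugeGroup.dist1 (GaugeField.plaqHol
              (Averaging.iter (fun i => BlockAveraging.blockAvg (P := F.P K) (j := i) T3UnitLawDensityEML.ℰp) K U) a)
              then (1 : ℝ) else 0)) ∂(T3UnitScaleTilt.gibbsK F T3UnitLawDensityEML.ℰp γ K) ≤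
          Real.exp (C₀ * (Fintype.card (Plaq (F.P K) K) : ℝ))) ∧
    (∀ (L : ℕ) (b₀ p₀ : ℝ), 0 < b₀ → 2 < p₀ → ∃ (c₀ C₀ γ₁ : ℝ), 0 < c₀ ∧ 0 < γ₁ ∧ γ₁ ≤ 1 ∧
      ∀ (F : T3Family) (γ : ℝ), F.L = L → 0 < γ → γ ≤ γ₁ → ∀ (K : ℕ),
        ∫ U, Real.exp (c₀ * γ⁻¹ *
            ∑ a : Plaq (F.P K) K, (if GaugeGroup.dist1 (GaugeField.plaqHol
              (Averaging.iter (fun i => BlockAveraging.blockAvg (P := F.P K) (j := i) T3UnitLawDensityEML.ℰp) K U) a) <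
                T3UnitScaleTilt.θBal F.L γ b₀ p₀ 0 then
              GaugeGroup.dist1 (GaugeField.plaqHol
                (Averaging.iter (fun i => BlockAveraging.blockAvg (P := F.P K) (j := i) T3UnitLawDensityEML.ℰp) K U) a) ^ 2 else 0))
            ∂(T3UnitScaleTilt.gibbsK F T3UnitLawDensityEML.ℰp γ K) ≤
          Real.exp (C₀ * (Fintype.card (Plaq (F.P K) K) : ℝ)))) :=
  ⟨unitStubs_of_cappedCoarseStiffnessL, fun h => cappedCoarseStiffnessL_of_unitStubs h.1 h.2⟩

end Crux

/-! ## §4 Skeleton v8's registered stubs (depth `j₀`) ⇔ the top-slice stubs: nothing registered earlier is lost -/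

section Registered

/-- ★★ **v8's S1 `stub_uniformLargeFieldCountDeep` ⇔ S1_top**: `⇒` through g13's bounded depths (`…LDeepTailReduction.uniformLargeFieldCountPos_of_deep`),
g9's height `0` (`…LBareUniformCount.uniformLargeFieldCount_of_pos`) and `j := K`; `⇐` by §2 with `j₀ := 0`.  The depth parameter is spurious.
[cite: Balaban1985UV3, (71) p.273] -/
theorem edgeDeep_iff_unitLargeFieldCount :
    (∀ (L : ℕ) (b₀ p₀ : ℝ), 0 < b₀ → 2 < p₀ → ∃ (j₀ : ℕ) (c₀ C₀ γ₁ : ℝ), 0 < c₀ ∧ 0 < γ₁ ∧ γ₁ ≤ 1 ∧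
      ∀ (F : T3Family) (γ : ℝ), F.L = L → 0 < γ → γ ≤ γ₁ → ∀ (K j : ℕ), j₀ < j → j ≤ K →
        ∫ U, Real.exp (c₀ * B10.pFun b₀ p₀ (Real.sqrt (γ * ((F.L : ℝ)⁻¹) ^ (K - j))) ^ 2 *
            ∑ a : Plaq (F.P K) j, (if T3UnitScaleTilt.θBal F.L γ b₀ p₀ (K - j) ≤ GaugeGroup.dist1 (GaugeField.plaqHol
              (Averaging.iter (fun i => BlockAveraging.blockAvg (P := F.P K) (j := i) T3UnitLawDensityEML.ℰp) j U) a)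
              then (1 : ℝ) else 0)) ∂(T3UnitScaleTilt.gibbsK F T3UnitLawDensityEML.ℰp γ K) ≤
          Real.exp (C₀ * (Fintype.card (Plaq (F.P K) j) : ℝ))) ↔
    (∀ (L : ℕ) (b₀ p₀ : ℝ), 0 < b₀ → 2 < p₀ → ∃ (c₀ C₀ γ₁ : ℝ), 0 < c₀ ∧ 0 < γ₁ ∧ γ₁ ≤ 1 ∧
      ∀ (F : T3Family) (γ : ℝ), F.L = L → 0 < γ → γ ≤ γ₁ → ∀ (K : ℕ),
        ∫ U, Real.exp (c₀ * B10.pFun b₀ p₀ (Real.sqrt γ) ^ 2 *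
            ∑ a : Plaq (F.P K) K, (if T3UnitScaleTilt.θBal F.L γ b₀ p₀ 0 ≤ GaugeGroup.dist1 (GaugeField.plaqHol
              (Averaging.iter (fun i => BlockAveraging.blockAvg (P := F.P K) (j := i) T3UnitLawDensityEML.ℰp) K U) a)
              then (1 : ℝ) else 0)) ∂(T3UnitScaleTilt.gibbsK F T3UnitLawDensityEML.ℰp γ K) ≤
          Real.exp (C₀ * (Fintype.card (Plaq (F.P K) K) : ℝ))) := by
  refine ⟨fun h => unitLargeFieldCount_of_uniformLargeFieldCount
    (uniformLargeFieldCount_of_pos (uniformLargeFieldCountPos_of_deep h)), fun h L b₀ p₀ hb₀ hp₀ => ?_⟩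
  obtain ⟨c₀, C₀, γ₁, hc₀, hγ₁, hγ₁1, h'⟩ := uniformLargeFieldCount_of_unitLargeFieldCount h L b₀ p₀ hb₀ hp₀
  exact ⟨0, c₀, C₀, γ₁, hc₀, hγ₁, hγ₁1, fun F γ hFL hγ hγγ₁ K j _ hjK => h' F γ hFL hγ hγγ₁ K j hjK⟩

/-- ★★ **v8's S2 `stub_subThresholdStiffnessDeep` ⇔ S2_top**: `⇒` through g14's `…LThreeTails.subThresholdStiffness_of_deep_and_ubs` fed with the
uncapped bare stiffness `ubs_of_uma` (g12) of the CLOSED stub S3 `…LUniformMeanAction.stub_uniformMeanAction` (g15: the uniform mean action of the Wilson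
law on all of Bałaban's three-tori), then `j := K`; `⇐` by §2 with `j₀ := 0`.  The depth parameter is spurious. [cite: Balaban1985UV3, (5) p.256] -/
theorem bulkDeep_iff_unitSubThresholdStiffness :
    (∀ (L : ℕ) (b₀ p₀ : ℝ), 0 < b₀ → 2 < p₀ → ∃ (j₀ : ℕ) (c₀ C₀ γ₁ : ℝ), 0 < c₀ ∧ 0 < γ₁ ∧ γ₁ ≤ 1 ∧
      ∀ (F : T3Family) (γ : ℝ), F.L = L → 0 < γ → γ ≤ γ₁ → ∀ (K j : ℕ), j₀ < j → j ≤ K →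
        ∫ U, Real.exp (c₀ * (γ * ((F.L : ℝ)⁻¹) ^ (K - j))⁻¹ *
            ∑ a : Plaq (F.P K) j, (if GaugeGroup.dist1 (GaugeField.plaqHol
              (Averaging.iter (fun i => BlockAveraging.blockAvg (P := F.P K) (j := i) T3UnitLawDensityEML.ℰp) j U) a) <
                T3UnitScaleTilt.θBal F.L γ b₀ p₀ (K - j) then
              GaugeGroup.dist1 (GaugeField.plaqHol
                (Averaging.iter (fun i => BlockAveraging.blockAvg (P := F.P K) (j := i) T3UnitLawDensityEML.ℰp) j U) a) ^ 2 else 0))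
            ∂(T3UnitScaleTilt.gibbsK F T3UnitLawDensityEML.ℰp γ K) ≤
          Real.exp (C₀ * (Fintype.card (Plaq (F.P K) j) : ℝ))) ↔
    (∀ (L : ℕ) (b₀ p₀ : ℝ), 0 < b₀ → 2 < p₀ → ∃ (c₀ C₀ γ₁ : ℝ), 0 < c₀ ∧ 0 < γ₁ ∧ γ₁ ≤ 1 ∧
      ∀ (F : T3Family) (γ : ℝ), F.L = L → 0 < γ → γ ≤ γ₁ → ∀ (K : ℕ),
        ∫ U, Real.exp (c₀ * γ⁻¹ *
            ∑ a : Plaq (F.P K) K, (if GaugeGroup.dist1 (GaugeField.plaqHol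
              (Averaging.iter (fun i => BlockAveraging.blockAvg (P := F.P K) (j := i) T3UnitLawDensityEML.ℰp) K U) a) <
                T3UnitScaleTilt.θBal F.L γ b₀ p₀ 0 then
              GaugeGroup.dist1 (GaugeField.plaqHol
                (Averaging.iter (fun i => BlockAveraging.blockAvg (P := F.P K) (j := i) T3UnitLawDensityEML.ℰp) K U) a) ^ 2 else 0))
            ∂(T3UnitScaleTilt.gibbsK F T3UnitLawDensityEML.ℰp γ K) ≤
          Real.exp (C₀ * (Fintype.card (Plaq (F.P K) K) : ℝ))) := by
  refine ⟨fun h => unitSubThresholdStiffness_of_subThresholdStiffness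
    (subThresholdStiffness_of_deep_and_ubs h (ubs_of_uma stub_uniformMeanAction)), fun h L b₀ p₀ hb₀ hp₀ => ?_⟩
  obtain ⟨c₀, C₀, γ₁, hc₀, hγ₁, hγ₁1, h'⟩ := subThresholdStiffness_of_unitSubThresholdStiffness h L b₀ p₀ hb₀ hp₀
  exact ⟨0, c₀, C₀, γ₁, hc₀, hγ₁, hγ₁1, fun F γ hFL hγ hγγ₁ K j _ hjK => h' F γ hFL hγ hγγ₁ K j hjK⟩

end Registered

end Summit.QuantumFields.YangMills.Theorems.CoarseStiffnessTailUnitLatticeStubs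

end
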